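import Literature.NumberTheory.IwasawaTheory.ClassicalMuVanishesAdjoinIOfNarrowDefectLayerOne
import Literature.NumberTheory.NumberFields.CubicFieldUnitSignatureCertificate
import Summits.BirchSwinnertonDyer.BirchSwinnertonDyer.Theorems.ByReductionTypeAtTwoFineSelmerConjAAtTwoAdditivePotGoodClassNumberOne1257
import Summits.BirchSwinnertonDyer.BirchSwinnertonDyer.Theorems.ByReductionTypeAtTwoFineSelmerConjAAtTwoAdditivePotGoodClassNumberOneCriterion
import Summits.BirchSwinnertonDyer.BirchSwinnertonDyer.Theorems.ByReductionTypeAtTwoFineSelmerConjAAtTwoAdditivePotGoodInertDoor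
import Mathlib.LinearAlgebra.Matrix.NonsingularInverse
import HarnessLib

/-!
# Route `ByReductionTypeAtTwo` (rung K4), crux C1″ `FineSelmerConjAAtTwoAdditivePotGood` (item stmt-BirchSwinnertonDyer-22615):
# THE NARROW-DEFECT CERTIFICATE FOR THE TOTALLY REAL CUBIC FIELD OF DISCRIMINANT `1257`, LAYER `0` —
# `#(U⁺/U²)(ℚ(θ)) = 2`, `θ³ = θ² + 14θ + 15` (KERNEL; the `2`-torsion field of the census row `100560c1`), and the generic
# unit-signature counting lemmas (a `--supports 22615` file; seat `bsd-2adic-k4-w1` GEN 9; feeds the narrow-defect door)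

HONEST FRAMING (cell `bsd-2adic`, D-0036/D-0054/D-0152): KERNEL theorems about ONE cubic number field; no elliptic curve, no named fact,
no `sorry`. Closes nothing at the `∀`-level; nothing booked; BSD is not proved by any of this.

THE CERTIFICATE (`b = θ`; units found by a local search, verified EXACTLY here): units `−1` and `2 + b` (`(2 + b)(8 + 3b − b²) = 1`) have
independent signs at the real roots `r₀ ∈ (−2.258152, −2.258151)` and `r₁ ∈ (−1.419939, −1.419938)` ⟹ `#sign(U) ≥ 4`; the unit `b² − 2`
(`(b² − 2)(127 + 29b − 12b²) = 1`) is TOTALLY POSITIVE — `(b² − 2)(b² − 3b − 11)² = (3 + 2b)² + (2 + b)²` — and NOT the square of a unit —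
`b² − 2 ≡ −1 (mod 1 + b)`, `|N(1 + b)| = 3`, and `−1` is not a square in a ring with `3` elements — ⟹ `#(U⁺/U²) ≥ 2`; as
`#(U⁺/U²)·#sign(U) = 2³` (tree `card_totPosUnitsModSq_mul_card_range_signVec`): **`#(U⁺/U²)(ℚ(θ)) = 2`** (narrow defect `1`, `h⁺ = 2·h = 2`;
Cohen's table B.4: `d = 1257`). Layer `1` (`ℚ(θ, √2)`) is the sequel file.

* §0 generic (any number field): `two_pow_le_card_range_signVec` (an invertible `k × k` sign matrix over `𝔽₂` ⟹ `#sign(U) ≥ 2^k`),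
  `two_le_card_totPosUnitsModSq_of_not_sq`, `card_totPosUnitsModSq_eq_two_of_bounds`, `not_exists_sq_eq_of_absNorm_eq_three`
  (a unit `≡ −1` modulo a principal ideal of norm `3` is not a square).
* §1 `ℚ(θ)`, `d = 1257`: `exists_three_ringHom_adjoin_d1257` (the three real embeddings with located images), `isTotallyReal_adjoin_d1257`,
  `totallyPositive_sq_sub_two_d1257`, `not_exists_sq_eq_sq_sub_two_d1257`, **`card_totPosUnitsModSq_adjoin_d1257`**.

References: [FrohlichTaylor1990] Ch. V §1 (1.10)–(1.13); [Cohen1993] §4.1.3, App. B (d = 1257); [Marcus1977] Ch. 5 Thm. 22 (norms of ideals).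
-/

set_option autoImplicit false
-- sibling precedent: the directory name repeats the summit name
set_option linter.dupNamespace false

noncomputable section

open scoped Classical IntermediateField NumberField

namespace Summit.BirchSwinnertonDyer.BirchSwinnertonDyer.Theorems.AddKatoTwo

open Polynomial IsDedekindDomain NumberField Field IntermediateField
  Literature.NumberTheory.EllipticCurves Literature.NumberTheory.IwasawaTheory Literature.NumberTheory.NumberFields
  Literature.Geometry.Kaehler.ComplexTorus

/-! ## §0 Generic counting lemmas -/

section Generic

variable {K : Type} [Field K] [NumberField K]

/-- **`#sign(U) ≥ 2^k` from `k` units whose sign matrix at `k` real embeddings is invertible over `𝔽₂`.** The products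
`∏_{ε_i = 1} u_i` have signatures `ε·M` (`sign` is a homomorphism), pairwise distinct when `M` is invertible.
[cite: FrohlichTaylor1990, Ch. V §1 (1.10)–(1.12), pp. 163–164] -/
theorem two_pow_le_card_range_signVec {k : ℕ} (u : Fin k → (𝓞 K)ˣ) (ρ : Fin k → (K →+* ℝ))
    (M : Matrix (Fin k) (Fin k) (ZMod 2)) (hM : ∀ i j, signVec (u i) (ρ j) = M i j) (hdet : IsUnit M) :
    2 ^ k ≤ Nat.card (Set.range (signVec (K := K))) := by
  classical
  set f : (Fin k → ZMod 2) → Set.range (signVec (K := K)) :=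
    fun ε => ⟨signVec (∏ i, if ε i = 1 then u i else 1), _, rfl⟩ with hf
  have hval : ∀ ε j, signVec (∏ i, if ε i = 1 then u i else 1) (ρ j) = Matrix.vecMul ε M j := by
    intro ε j
    rw [signVec_prod, Matrix.vecMul, dotProduct, Finset.sum_apply]
    refine Finset.sum_congr rfl fun i _ => ?_
    by_cases h : ε i = 1
    · rw [if_pos h, hM, h, one_mul]
    · have h0 : ε i = 0 := by
        have : ∀ x : ZMod 2, x ≠ 1 → x = 0 := by decide
        exact this _ h
      rw [if_neg h, signVec_one, h0, zero_mul]; rfl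
  have hinj : Function.Injective f := by
    intro ε ε' h
    have h' : Matrix.vecMul ε M = Matrix.vecMul ε' M := by
      funext j
      rw [← hval ε j, ← hval ε' j]
      exact congrFun (congrArg Subtype.val h) (ρ j)
    exact (Matrix.vecMul_injective_iff_isUnit.mpr hdet) h'
  have h := Nat.card_le_card_of_injective f hinj
  rwa [Nat.card_fun, Nat.card_eq_fintype_card (α := ZMod 2), ZMod.card, Nat.card_eq_fintype_card, Fintype.card_fin] at h

/-- **`#(U⁺/U²) ≥ 2` from ONE totally positive unit that is not a square of a unit.**
[cite: FrohlichTaylor1990, Ch. V §1 (1.12), p. 164] -/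
theorem two_le_card_totPosUnitsModSq_of_not_sq (u : (𝓞 K)ˣ) (hu : ∀ σ : K →+* ℝ, 0 < σ ((u : 𝓞 K) : K))
    (hns : ¬ ∃ ε : (𝓞 K)ˣ, u = ε ^ 2) : 2 ≤ Nat.card (TotPosUnitsModSq K) := by
  have h1 : ∀ σ : K →+* ℝ, 0 < σ (((1 : (𝓞 K)ˣ) : 𝓞 K) : K) := fun σ => by simp
  have hne : (Quot.mk _ ⟨u, hu⟩ : TotPosUnitsModSq K) ≠ Quot.mk _ ⟨1, h1⟩ := by
    intro h
    rw [totPosUnitsModSq_mk_eq_mk_iff] at h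
    obtain ⟨ε, hε⟩ := h
    exact hns ⟨ε, by simpa using hε⟩
  have : Nontrivial (TotPosUnitsModSq K) := ⟨⟨_, _, hne⟩⟩
  exact Finite.one_lt_card_iff_nontrivial.mpr this

/-- **`#(U⁺/U²) = 2`** for a totally real field of degree `n + 1` with `#sign(U) ≥ 2ⁿ` and `#(U⁺/U²) ≥ 2` (`#(U⁺/U²)·#sign(U) = 2^{n+1}`).
[cite: FrohlichTaylor1990, Ch. V §1 (1.12)–(1.13), p. 164] -/
theorem card_totPosUnitsModSq_eq_two_of_bounds [IsTotallyReal K] {n : ℕ} (hn : Module.finrank ℚ K = n + 1)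
    (hsig : 2 ^ n ≤ Nat.card (Set.range (signVec (K := K)))) (htwo : 2 ≤ Nat.card (TotPosUnitsModSq K)) :
    Nat.card (TotPosUnitsModSq K) = 2 := by
  have h := card_totPosUnitsModSq_mul_card_range_signVec (K := K)
  rw [hn, pow_succ] at h
  have hle : 2 ^ n * Nat.card (TotPosUnitsModSq K) ≤ 2 ^ n * 2 := by
    calc 2 ^ n * Nat.card (TotPosUnitsModSq K) ≤ Nat.card (Set.range (signVec (K := K))) * Nat.card (TotPosUnitsModSq K) :=
          Nat.mul_le_mul_right _ hsig
      _ = 2 ^ n * 2 := by rw [mul_comm, h]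
  have hle2 : Nat.card (TotPosUnitsModSq K) ≤ 2 := Nat.le_of_mul_le_mul_left hle (pow_pos two_pos n)
  omega

/-- **A unit congruent to `−1` modulo a principal ideal of norm `3` is not the square of a unit**: if `|N(π)| = 3` then `𝓞 K/(π)`
is a ring with `3` elements (`≅ 𝔽₃`), where `−1` is not a square. Stated with the congruence as `u + 1 ∈ (π)`.
[cite: Marcus1977, Ch. 5 Thm. 22 (c) (`‖(α)‖ = |N(α)|`)] [cite: Cohen1993, §4.1.3] -/
theorem not_exists_sq_eq_of_absNorm_eq_three (u : (𝓞 K)ˣ) (π : 𝓞 K) (hπ : (Algebra.norm ℤ π).natAbs = 3)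
    (hcong : (u : 𝓞 K) + 1 ∈ Ideal.span {π}) : ¬ ∃ ε : (𝓞 K)ˣ, u = ε ^ 2 := by
  rintro ⟨ε, hε⟩
  set I : Ideal (𝓞 K) := Ideal.span {π} with hI
  have hI3 : Ideal.absNorm I = 3 := by rw [hI, Ideal.absNorm_span_singleton, hπ]
  have hcard : Nat.card (𝓞 K ⧸ I) = 3 := by rw [← Submodule.cardQuot_apply, ← Ideal.absNorm_apply, hI3]
  haveI : Finite (𝓞 K ⧸ I) := Nat.finite_of_card_ne_zero (by rw [hcard]; norm_num)
  letI : Fintype (𝓞 K ⧸ I) := Fintype.ofFinite _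
  have hcard' : Fintype.card (𝓞 K ⧸ I) = 3 := by rw [← Nat.card_eq_fintype_card, hcard]
  set ψ : ZMod 3 ≃+* 𝓞 K ⧸ I := ZMod.ringEquivOfPrime (𝓞 K ⧸ I) Nat.prime_three hcard' with hψ
  -- in the quotient, `ε̄² = ū = −1`
  have hq : Ideal.Quotient.mk I ((ε : 𝓞 K) ^ 2) = -1 := by
    have h1 : (ε : 𝓞 K) ^ 2 = (u : 𝓞 K) := by rw [hε, Units.val_pow_eq_pow_val]
    rw [h1, eq_neg_iff_add_eq_zero, ← map_one (Ideal.Quotient.mk I), ← map_add, Ideal.Quotient.eq_zero_iff_mem]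
    exact hcong
  set w : ZMod 3 := ψ.symm (Ideal.Quotient.mk I (ε : 𝓞 K)) with hw
  have hw2 : w ^ 2 = -1 := by
    rw [hw, ← map_pow, ← map_pow, hq, map_neg, map_one]
  have : ∀ z : ZMod 3, z ^ 2 ≠ -1 := by decide
  exact this w hw2

end Generic

/-! ## §1 The cubic field of discriminant `1257`: `#(U⁺/U²)(ℚ(θ)) = 2` -/

section Cubic1257

variable {θ : AlgebraicClosure ℚ}

/-- The cubic relation as a real equation gives a root of `Cubic.toPoly` over `ℝ`. [folklore] -/
private theorem aeval_real_of_eq_d1257 {x : ℝ} (hx : x ^ 3 + (-1) * x ^ 2 + (-14) * x + (-15) = 0) :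
    aeval x (Cubic.toPoly ⟨1, ((-1 : ℤ) : ℚ), ((-14 : ℤ) : ℚ), ((-15 : ℤ) : ℚ)⟩) = 0 := by
  simp only [Cubic.toPoly, map_one, one_mul, aeval_add, aeval_mul, aeval_C, aeval_X_pow, aeval_X, eq_ratCast,
    Rat.cast_intCast]
  push_cast
  linear_combination hx

/-- **The three real embeddings of `ℚ(θ)`, `θ³ − θ² − 14θ − 15 = 0`**, with located images: `ρ₀(θ) ∈ (−2.258152, −2.258151)`,
`ρ₁(θ) ∈ (−1.419939, −1.419938)`, `ρ₂(θ) ∈ (4.67809, 4.678091)` (IVT + lifting; tree `exists_ringHom_adjoin_apply_gen_eq`).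
[cite: Cohen1993, §4.1.3 (real roots and signatures), App. B (d = 1257)] -/
theorem exists_three_ringHom_adjoin_d1257 (hθ : aeval θ (Cubic.toPoly ⟨1, ((-1 : ℤ) : ℚ), ((-14 : ℤ) : ℚ), ((-15 : ℤ) : ℚ)⟩) = 0) :
    ∃ (ρ₀ ρ₁ ρ₂ : ↥ℚ⟮θ⟯ →+* ℝ) (x₀ x₁ x₂ : ℝ),
      ρ₀ (AdjoinSimple.gen ℚ θ) = x₀ ∧ ρ₁ (AdjoinSimple.gen ℚ θ) = x₁ ∧ ρ₂ (AdjoinSimple.gen ℚ θ) = x₂ ∧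
      (-282269 / 125000 : ℝ) < x₀ ∧ x₀ < -2258151 / 1000000 ∧ (-1419939 / 1000000 : ℝ) < x₁ ∧ x₁ < -709969 / 500000 ∧
      (467809 / 100000 : ℝ) < x₂ ∧ x₂ < 4678091 / 1000000 := by
  obtain ⟨x₀, hl₀, hu₀, hx₀⟩ := exists_cubic_root_Ioo_of_neg_of_pos (p := (-1 : ℝ)) (q := -14) (r := -15)
    (l := -282269 / 125000) (u := -2258151 / 1000000) (by norm_num) (by norm_num) (by norm_num)
  obtain ⟨x₁, hl₁, hu₁, hx₁⟩ := exists_cubic_root_Ioo_of_pos_of_neg (p := (-1 : ℝ)) (q := -14) (r := -15)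
    (l := -1419939 / 1000000) (u := -709969 / 500000) (by norm_num) (by norm_num) (by norm_num)
  obtain ⟨x₂, hl₂, hu₂, hx₂⟩ := exists_cubic_root_Ioo_of_neg_of_pos (p := (-1 : ℝ)) (q := -14) (r := -15)
    (l := 467809 / 100000) (u := 4678091 / 1000000) (by norm_num) (by norm_num) (by norm_num)
  obtain ⟨ρ₀, hρ₀⟩ := exists_ringHom_adjoin_apply_gen_eq (P := ⟨1, ((-1 : ℤ) : ℚ), ((-14 : ℤ) : ℚ), ((-15 : ℤ) : ℚ)⟩) rfl
    irreducible_cubic_disc_1257 hθ (aeval_real_of_eq_d1257 hx₀)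
  obtain ⟨ρ₁, hρ₁⟩ := exists_ringHom_adjoin_apply_gen_eq (P := ⟨1, ((-1 : ℤ) : ℚ), ((-14 : ℤ) : ℚ), ((-15 : ℤ) : ℚ)⟩) rfl
    irreducible_cubic_disc_1257 hθ (aeval_real_of_eq_d1257 hx₁)
  obtain ⟨ρ₂, hρ₂⟩ := exists_ringHom_adjoin_apply_gen_eq (P := ⟨1, ((-1 : ℤ) : ℚ), ((-14 : ℤ) : ℚ), ((-15 : ℤ) : ℚ)⟩) rfl
    irreducible_cubic_disc_1257 hθ (aeval_real_of_eq_d1257 hx₂)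
  exact ⟨ρ₀, ρ₁, ρ₂, x₀, x₁, x₂, hρ₀, hρ₁, hρ₂, hl₀, hu₀, hl₁, hu₁, hl₂, hu₂⟩

/-- **`ℚ(θ)` (`d = 1257`) is TOTALLY REAL** (three distinct real embeddings, degree `3`). [cite: Cohen1993, App. B (d = 1257, signature (3,0))] -/
theorem isTotallyReal_adjoin_d1257 (hθ : aeval θ (Cubic.toPoly ⟨1, ((-1 : ℤ) : ℚ), ((-14 : ℤ) : ℚ), ((-15 : ℤ) : ℚ)⟩) = 0) :
    haveI : FiniteDimensional ℚ ↥ℚ⟮θ⟯ :=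
      IntermediateField.adjoin.finiteDimensional ⟨_, Cubic.monic_of_a_eq_one', by rwa [← aeval_def]⟩
    haveI : NumberField ↥ℚ⟮θ⟯ := NumberField.mk
    IsTotallyReal ↥ℚ⟮θ⟯ := by
  haveI : FiniteDimensional ℚ ↥ℚ⟮θ⟯ :=
    IntermediateField.adjoin.finiteDimensional ⟨_, Cubic.monic_of_a_eq_one', by rwa [← aeval_def]⟩
  haveI : NumberField ↥ℚ⟮θ⟯ := NumberField.mk
  have h3 : Module.finrank ℚ ↥ℚ⟮θ⟯ = 3 := finrank_adjoin_eq_three_of_irreducible irreducible_cubic_disc_1257 hθ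
  obtain ⟨ρ₀, ρ₁, ρ₂, x₀, x₁, x₂, hρ₀, hρ₁, hρ₂, hl₀, hu₀, hl₁, hu₁, hl₂, hu₂⟩ := exists_three_ringHom_adjoin_d1257 hθ
  have hne : ∀ {φ ψ : ↥ℚ⟮θ⟯ →+* ℝ} {a c : ℝ}, φ (AdjoinSimple.gen ℚ θ) = a → ψ (AdjoinSimple.gen ℚ θ) = c → a ≠ c → φ ≠ ψ := by
    intro φ ψ a c ha hc hac h; rw [h] at ha; exact hac (ha.symm.trans hc)
  have h01 : ρ₀ ≠ ρ₁ := hne hρ₀ hρ₁ (by intro h; linarith)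
  have h02 : ρ₀ ≠ ρ₂ := hne hρ₀ hρ₂ (by intro h; linarith)
  have h12 : ρ₁ ≠ ρ₂ := hne hρ₁ hρ₂ (by intro h; linarith)
  refine isTotallyReal_of_three_realEmbeddings h3 ![ρ₀, ρ₁, ρ₂] ?_
  intro a c hac
  fin_cases a <;> fin_cases c <;> simp_all

/-- **`b² − 2` is a TOTALLY POSITIVE unit of `𝓞 ℚ(θ)`** (`d = 1257`): the identity `(b² − 2)(b² − 3b − 11)² = (3 + 2b)² + (2 + b)²`
exhibits `σ(b² − 2)` as a quotient of a sum of two squares by a square at every real embedding `σ` (`σ(b² − 3b − 11) ≠ 0`, else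
`σ(3 + 2b) = σ(2 + b) = 0`). [cite: Cohen1993, §4.1.3 and App. B (d = 1257)] -/
theorem totallyPositive_sq_sub_two_d1257 (b : 𝓞 ↥ℚ⟮θ⟯) (hb : b ^ 3 + (-1 : ℤ) * b ^ 2 + (-14 : ℤ) * b + (-15 : ℤ) = 0)
    (σ : ↥ℚ⟮θ⟯ →+* ℝ) : 0 < σ (((b ^ 2 - 2 : 𝓞 ↥ℚ⟮θ⟯)) : ↥ℚ⟮θ⟯) := by
  have hb' : b ^ 3 - b ^ 2 - 14 * b - 15 = 0 := by push_cast at hb; linear_combination hb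
  have hid : (b ^ 2 - 2) * (b ^ 2 - 3 * b - 11) ^ 2 = (3 + 2 * b) ^ 2 + (2 + b) ^ 2 := by
    linear_combination (17 - 6 * b - 5 * b ^ 2 + b ^ 3) * hb'
  have hidR : (σ ((b : 𝓞 ↥ℚ⟮θ⟯) : ↥ℚ⟮θ⟯) ^ 2 - 2) * (σ ((b : 𝓞 ↥ℚ⟮θ⟯) : ↥ℚ⟮θ⟯) ^ 2 - 3 * σ ((b : 𝓞 ↥ℚ⟮θ⟯) : ↥ℚ⟮θ⟯) - 11) ^ 2 =
      (3 + 2 * σ ((b : 𝓞 ↥ℚ⟮θ⟯) : ↥ℚ⟮θ⟯)) ^ 2 + (2 + σ ((b : 𝓞 ↥ℚ⟮θ⟯) : ↥ℚ⟮θ⟯)) ^ 2 := by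
    have h := congrArg (fun z : 𝓞 ↥ℚ⟮θ⟯ => σ ((z : 𝓞 ↥ℚ⟮θ⟯) : ↥ℚ⟮θ⟯)) hid
    push_cast at h
    simp only [map_add, map_sub, map_mul, map_pow, map_ofNat] at h
    linear_combination h
  have hval : σ (((b ^ 2 - 2 : 𝓞 ↥ℚ⟮θ⟯)) : ↥ℚ⟮θ⟯) = σ ((b : 𝓞 ↥ℚ⟮θ⟯) : ↥ℚ⟮θ⟯) ^ 2 - 2 := by
    push_cast; simp only [map_sub, map_pow, map_ofNat]
  rw [hval]
  set x : ℝ := σ ((b : 𝓞 ↥ℚ⟮θ⟯) : ↥ℚ⟮θ⟯) with hx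
  have hc : x ^ 2 - 3 * x - 11 ≠ 0 := by
    intro h0
    have hsum : (3 + 2 * x) ^ 2 + (2 + x) ^ 2 = 0 := by rw [← hidR, h0]; ring
    nlinarith [sq_nonneg (3 + 2 * x), sq_nonneg (2 + x)]
  have hpos : 0 < (x ^ 2 - 3 * x - 11) ^ 2 := by positivity
  have hrhs : 0 < (3 + 2 * x) ^ 2 + (2 + x) ^ 2 := by
    rcases lt_or_ge x (-2) with h | h <;> nlinarith [sq_nonneg (3 + 2 * x), sq_nonneg (2 + x)]
  by_contra hle
  push Not at hle
  have h := mul_nonpos_of_nonpos_of_nonneg hle hpos.le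
  rw [hidR] at h
  linarith

/-- **`b² − 2` is NOT the square of a unit of `𝓞 ℚ(θ)`** (`d = 1257`): `b² − 2 + 1 = (1 + b)(b − 1)` and `|N(1 + b)| = 3`
(`not_exists_sq_eq_of_absNorm_eq_three`). [cite: Cohen1993, §4.1.3 and App. B (d = 1257)] [cite: Marcus1977, Ch. 5 Thm. 22 (c)] -/
theorem not_exists_sq_eq_sq_sub_two_d1257 (hθ : aeval θ (Cubic.toPoly ⟨1, ((-1 : ℤ) : ℚ), ((-14 : ℤ) : ℚ), ((-15 : ℤ) : ℚ)⟩) = 0)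
    (b : 𝓞 ↥ℚ⟮θ⟯) (hb : b ^ 3 + (-1 : ℤ) * b ^ 2 + (-14 : ℤ) * b + (-15 : ℤ) = 0)
    (e : (𝓞 ↥ℚ⟮θ⟯)ˣ) (he : (e : 𝓞 ↥ℚ⟮θ⟯) = b ^ 2 - 2) : ¬ ∃ ε : (𝓞 ↥ℚ⟮θ⟯)ˣ, e = ε ^ 2 := by
  haveI : FiniteDimensional ℚ ↥ℚ⟮θ⟯ :=
    IntermediateField.adjoin.finiteDimensional ⟨_, Cubic.monic_of_a_eq_one', by rwa [← aeval_def]⟩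
  haveI : NumberField ↥ℚ⟮θ⟯ := NumberField.mk
  have h3 : Module.finrank ℚ ↥ℚ⟮θ⟯ = 3 := finrank_adjoin_eq_three_of_irreducible irreducible_cubic_disc_1257 hθ
  have hπ : (Algebra.norm ℤ (1 + b)).natAbs = 3 := by
    have hN := natAbs_norm_coords_eq_natAbs_normPoly ↥ℚ⟮θ⟯ h3 b (p := -1) (q := -14) (r := -15)
      irreducible_cubic_disc_1257 hb 1 1 0
    norm_num at hN
    exact hN
  refine not_exists_sq_eq_of_absNorm_eq_three e (1 + b) hπ ?_
  rw [he, Ideal.mem_span_singleton']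
  exact ⟨b - 1, by ring⟩

/-- **`#(U⁺/U²)(ℚ(θ)) = 2` for the cubic field of discriminant `1257`** (narrow defect `1`: `h⁺ = 2h`), KERNEL: `#sign(U) ≥ 4` (units `−1`,
`2 + b` at `ρ₀`, `ρ₁`), `#(U⁺/U²) ≥ 2` (`b² − 2` totally positive, non-square), product `= 2³`. [cite: Cohen1993, App. B (d = 1257)]
[cite: FrohlichTaylor1990, Ch. V §1 (1.12)–(1.13), p. 164] -/
theorem card_totPosUnitsModSq_adjoin_d1257 (hθ : aeval θ (Cubic.toPoly ⟨1, ((-1 : ℤ) : ℚ), ((-14 : ℤ) : ℚ), ((-15 : ℤ) : ℚ)⟩) = 0) :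
    haveI : FiniteDimensional ℚ ↥ℚ⟮θ⟯ :=
      IntermediateField.adjoin.finiteDimensional ⟨_, Cubic.monic_of_a_eq_one', by rwa [← aeval_def]⟩
    haveI : NumberField ↥ℚ⟮θ⟯ := NumberField.mk
    Nat.card (TotPosUnitsModSq ↥ℚ⟮θ⟯) = 2 := by
  haveI : FiniteDimensional ℚ ↥ℚ⟮θ⟯ :=
    IntermediateField.adjoin.finiteDimensional ⟨_, Cubic.monic_of_a_eq_one', by rwa [← aeval_def]⟩
  haveI : NumberField ↥ℚ⟮θ⟯ := NumberField.mk
  haveI : IsTotallyReal ↥ℚ⟮θ⟯ := isTotallyReal_adjoin_d1257 hθ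
  set K := ℚ⟮θ⟯ with hKdef
  have h3 : Module.finrank ℚ K = 3 := finrank_adjoin_eq_three_of_irreducible irreducible_cubic_disc_1257 hθ
  obtain ⟨ρ₀, ρ₁, ρ₂, x₀, x₁, x₂, hρ₀, hρ₁, hρ₂, hl₀, hu₀, hl₁, hu₁, hl₂, hu₂⟩ := exists_three_ringHom_adjoin_d1257 hθ
  obtain ⟨b, hbθ, hb⟩ := exists_ringOfIntegers_cubic_root (p := -1) (q := -14) (r := -15) hθ
  have hbgen : algebraMap (𝓞 K) K b = AdjoinSimple.gen ℚ θ := Subtype.ext hbθ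
  have hb' : b ^ 3 - b ^ 2 - 14 * b - 15 = 0 := by push_cast at hb; linear_combination hb
  -- the units `2 + b` and `b² − 2`
  set e₁ : (𝓞 K)ˣ := Units.mkOfMulEqOne (2 + b) (8 + 3 * b - b ^ 2) (by linear_combination (-1 : 𝓞 K) * hb') with he₁def
  set e₂ : (𝓞 K)ˣ := Units.mkOfMulEqOne (b ^ 2 - 2) (127 + 29 * b - 12 * b ^ 2)
    (by linear_combination (17 - 12 * b) * hb') with he₂def
  have he₁ : ((e₁ : 𝓞 K) : K) = ((2 : ℤ) : K) + ((1 : ℤ) : K) * AdjoinSimple.gen ℚ θ + ((0 : ℤ) : K) * AdjoinSimple.gen ℚ θ ^ 2 := by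
    rw [he₁def, Units.val_mkOfMulEqOne, NumberField.RingOfIntegers.coe_eq_algebraMap, map_add, map_ofNat, hbgen]
    push_cast; ring
  -- sign matrix at `ρ₀`, `ρ₁`
  have hs : ∀ i j, signVec (![-1, e₁] i) (![ρ₀, ρ₁] j) = !![(1 : ZMod 2), 1; 1, 0] i j := by
    intro i j
    fin_cases i <;> fin_cases j
    · show signVec (-1) ρ₀ = 1; rw [signVec_neg_one]
    · show signVec (-1) ρ₁ = 1; rw [signVec_neg_one]
    · show signVec e₁ ρ₀ = 1
      exact signVec_apply_eq_one_of_neg ρ₀ e₁ hρ₀ he₁ (by push_cast; linarith)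
    · show signVec e₁ ρ₁ = 0
      exact signVec_apply_eq_zero_of_pos ρ₁ e₁ hρ₁ he₁ (by push_cast; linarith)
  have hdet : IsUnit (!![(1 : ZMod 2), 1; 1, 0]) := by
    haveI := invertibleOfRightInverse !![(1 : ZMod 2), 1; 1, 0] !![(0 : ZMod 2), 1; 1, 1] (by decide)
    exact isUnit_of_invertible _
  have hsig := two_pow_le_card_range_signVec ![-1, e₁] ![ρ₀, ρ₁] _ hs hdet
  -- `b² − 2`: totally positive, not a square
  have hpos : ∀ σ : K →+* ℝ, 0 < σ ((e₂ : 𝓞 K) : K) := fun σ => by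
    rw [he₂def, Units.val_mkOfMulEqOne]; exact totallyPositive_sq_sub_two_d1257 b hb σ
  have hns := not_exists_sq_eq_sq_sub_two_d1257 hθ b hb e₂ (by rw [he₂def, Units.val_mkOfMulEqOne])
  have htwo := two_le_card_totPosUnitsModSq_of_not_sq e₂ hpos hns
  exact card_totPosUnitsModSq_eq_two_of_bounds (n := 2) h3 hsig htwo

end Cubic1257

end Summit.BirchSwinnertonDyer.BirchSwinnertonDyer.Theorems.AddKatoTwo

end
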